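import Summits.QuantumAdvantage.QuantumAdvantage.Theorems.LinnikCubicClassGroupsDegreeOnePrimesEscapeLowerPITZeroSum
import Summits.QuantumAdvantage.QuantumAdvantage.Theorems.LinnikCubicClassGroupsDegreeOnePrimesEscapeLowerPITExplicit
import Summits.QuantumAdvantage.QuantumAdvantage.Theorems.LinnikCubicClassGroupsDegreeOnePrimesEscapeLowerPITSmoothedAux
import Literature.NumberTheory.LFunctions.ClassGroupLFunctionExceptionalZero
import HarnessLib

/-!
# The smoothed prime ideal sum of a number field is one-sidedly LARGE unless `ζ_K` has a real zero
# very close to `1` (from the log-free zero-density estimate for `ζ₁_K`, no Deuring–Heilbronn)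

Topic `Summits/QuantumAdvantage/QuantumAdvantage/Theorems`, helper for the stub
`stub_lowerPIT_of_density` (T5 of line `subgroup-orthogonality-escape`, crux `DegreeOnePrimesEscape`,
stmt-QuantumAdvantage-11543); cell B2b-1 (linnik-cubic), PART A.  HONEST FRAMING: the value of this
file is a THEOREM (kernel-checked lemmas) — not summit progress.

The `ζ_K` twin of `…PerCharacterDeficitSmoothedBound.lean` (`re_coefFordK_tzTest_le_mul`).  For `n > 1`,
density constants `b, D > 0`, `a ≥ 1` there are `ν ∈ (0, 1/64]` and `a₁ ≥ 1` such that for every number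
field `K` of degree `n` whose zeros of `ζ₁_K = (s−1)ζ_K` obey the log-free density bound
`Σ_{|γ| ≤ T, β ≥ α} m ≤ D e^{b(a log Q + log(T+4))(1−α)}` and every `x ≥ Q^{a₁}` (`Q = condQn K`,
`g = tzTest (log x) x^{−ν}`):

  `Σ_n Λ_K(n) g(log n) ≥ (24/25)·x`, OR `ζ_K(β₁) = 0` for some `β₁ ∈ (1 − 1/(8 log Q), 1)` with `(1 − β₁) log x < 4`

(`re_coefFordK_one_tzTest_ge_or_exceptional`).  Proof: the explicit formula read from below
(`re_coefFordK_one_tzTest_dichotomy`); the zeros inside `β ≤ 1 − c/(a log Q + log(|γ|+4))`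
(`c = min(c₀, 1/8)`, `c₀` the Landau–Page constant of `exists_exceptionalZero_const`) cost `≤ 3x/800` by
`zeroSum_dedekindZeta₁_zfr_le`; the at most one zero outside is real, simple (`exists_exceptionalZero_const`)
and `> 15/16`, and either `(1−β₁) log x ≥ 4` — then `x^{β₁}/β₁ ≤ (16/15)e^{−4}x ≤ x/50` — or
`β₁ ≤ 1 − 1/(8 log Q)` — impossible for `log x ≥ 32 log Q` — or it is reported; `m₀F(0)`, `J₁(0)`, `√x`
cost `≤ x/400` each (auxiliary estimates in `…LowerPITSmoothedAux.lean`).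
-/

noncomputable section

open Complex Real MeasureTheory Set Filter Topology
open scoped NumberField nonZeroDivisors
open Literature.NumberTheory.LFunctions Literature.NumberTheory.LFunctions.NumberField
  Literature.NumberTheory.LFunctions.EntireEF Literature.NumberTheory.LFunctions.TZWeight

namespace Summit.QuantumAdvantage.QuantumAdvantage.Theorems.DegreeOnePrimesEscape

/-! ### The smoothed sum -/

set_option maxHeartbeats 1600000 in
/-- **The smoothed prime ideal sum is large unless there is a real zero of `ζ_K` within `4/log x` of `1`**
(see the module docstring; general degree `n > 1`, density in `Q`-form as hypothesis). -/
theorem re_coefFordK_one_tzTest_ge_or_exceptional (n : ℕ) (hn : 1 < n) {b D a : ℝ} (hb : 0 < b)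
    (hD : 0 < D) (ha : 1 ≤ a) :
    ∃ ν a₁ : ℝ, 0 < ν ∧ ν ≤ 1 / 64 ∧ 1 ≤ a₁ ∧
    ∀ (K : Type) [Field K] [NumberField K], Module.finrank ℚ K = n →
      (∀ T : ℝ, 1 ≤ T → ∀ u : Finset ℂ,
        (∀ ρ ∈ u, dedekindZeta₁ K ρ = 0 ∧ 1 / 4 ≤ ρ.re ∧ ρ.re < 1 ∧ |ρ.im| ≤ T) →
        ∀ α : ℝ, α ≤ 1 →
          ∑ ρ ∈ u with α ≤ ρ.re, (analyticOrderNatAt (dedekindZeta₁ K) ρ : ℝ) ≤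
            D * Real.exp (b * (a * Real.log (ThornerZaman.condQn K) + Real.log (T + 4))) ^ (1 - α)) →
      ∀ x : ℝ, ThornerZaman.condQn K ^ a₁ ≤ x →
        24 / 25 * x ≤ (coefFordK (cgCoef (1 : ClassGroup (𝓞 K) →* ℂˣ)) (tzTest (Real.log x) (x ^ (-ν))) 0).re ∨
        ∃ β₁ : ℝ, 1 - 1 / (8 * Real.log (ThornerZaman.condQn K)) < β₁ ∧ β₁ < 1 ∧
          dedekindZetaCont K β₁ = 0 ∧ (1 - β₁) * Real.log x < 4 := by
  obtain ⟨ν, a₀, A₀, hν0, hν64, ha₀1, hA₀, hZ⟩ := zeroSum_dedekindZeta₁_zfr_le n hn hb hD ha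
  obtain ⟨c₀, hc₀, hpack⟩ := exists_exceptionalZero_const n
  obtain ⟨Al, hAl0, hAl⟩ := exists_norm_logDeriv_classGroupLFunction_left_le
  obtain ⟨M, hM1, hM⟩ := TZWeight.exists_smoothTransition_deriv_bound
  have hlC := leftLineConst_nonneg
  set c : ℝ := min c₀ (1 / 8) with hcdef
  have hc : 0 < c := lt_min hc₀ (by norm_num)
  have hcc₀ : c ≤ c₀ := min_le_left _ _
  have hc8 : c ≤ 1 / 8 := min_le_right _ _
  -- thresholds (`η = 1/100` in the bookkeeping of the sibling file)
  set Λ : ℝ := max 1 (Real.log (8 * A₀ / (1 / 100))) with hΛ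
  have hΛ0 : 0 ≤ Λ := le_trans zero_le_one (le_max_left _ _)
  set Λ₂ : ℝ := max 1 (Real.log 460800) with hΛ₂
  set CJ : ℝ := 8 * leftLineConst * Al * ((n : ℝ) + 1) * M with hCJ
  have hM0 : 0 ≤ M := by linarith
  have hCJ0 : 0 ≤ CJ := by positivity
  set Λ₃ : ℝ := max 1 (Real.log (400 * (CJ + 1))) with hΛ₃
  set a₁ : ℝ := max (max (max a₀ 32) (max (4 * a * Λ / c) (2 * Λ ^ 2 / c)))
    (max (Λ / (2 * ν)) (max Λ₂ Λ₃)) with ha₁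
  have ha₁a₀ : a₀ ≤ a₁ := le_trans (le_trans (le_max_left _ _) (le_max_left _ _)) (le_max_left _ _)
  have ha₁32 : (32 : ℝ) ≤ a₁ := le_trans (le_trans (le_max_right _ _) (le_max_left _ _)) (le_max_left _ _)
  have ha₁i : 4 * a * Λ / c ≤ a₁ := le_trans (le_trans (le_max_left _ _) (le_max_right _ _)) (le_max_left _ _)
  have ha₁i' : 2 * Λ ^ 2 / c ≤ a₁ := le_trans (le_trans (le_max_right _ _) (le_max_right _ _)) (le_max_left _ _)
  have ha₁ii : Λ / (2 * ν) ≤ a₁ := le_trans (le_max_left _ _) (le_max_right _ _)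
  have ha₁iii : Λ₂ ≤ a₁ := le_trans (le_trans (le_max_left _ _) (le_max_right _ _)) (le_max_right _ _)
  have ha₁iv : Λ₃ ≤ a₁ := le_trans (le_trans (le_max_right _ _) (le_max_right _ _)) (le_max_right _ _)
  have ha₁1 : (1 : ℝ) ≤ a₁ := by linarith
  refine ⟨ν, a₁, hν0, hν64, ha₁1, fun K _ _ hKn hdens x hx ↦ ?_⟩
  -- sizes
  have hK : 1 < Module.finrank ℚ K := by rw [hKn]; exact hn
  set Q : ℝ := ThornerZaman.condQn K with hQ
  have hQ12 : (12 : ℝ) ≤ Q := ThornerZaman.twelve_le_condQn (K := K) hK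
  have hQ1 : (1 : ℝ) < Q := by linarith
  have hlog12 : (2 : ℝ) ≤ Real.log 12 := by
    rw [Real.le_log_iff_exp_le (by norm_num)]
    have := Real.exp_one_lt_d9
    have h : Real.exp 2 = Real.exp 1 * Real.exp 1 := by rw [← Real.exp_add]; norm_num
    rw [h]; nlinarith [Real.exp_pos (1:ℝ)]
  have hlogQ : 2 ≤ Real.log Q := hlog12.trans (Real.log_le_log (by norm_num) hQ12)
  have hlogQ0 : 0 < Real.log Q := by linarith
  have hxa₀ : Q ^ a₀ ≤ x := le_trans (Real.rpow_le_rpow_of_exponent_le hQ1.le ha₁a₀) hx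
  have hxQ : Q ≤ x := by
    have : Q ^ (1 : ℝ) ≤ Q ^ a₁ := Real.rpow_le_rpow_of_exponent_le hQ1.le ha₁1
    rw [Real.rpow_one] at this; linarith
  have hx1 : 1 < x := by linarith
  have hx0 : 0 < x := by linarith
  set L : ℝ := Real.log x with hL
  have hLQ : a₁ * Real.log Q ≤ L := by
    have := Real.log_le_log (by positivity) hx
    rwa [Real.log_rpow (by linarith)] at this
  have hL2a : 2 * a₁ ≤ L := by nlinarith
  have hL64 : 64 ≤ L := by nlinarith
  have hL0 : 0 < L := by linarith
  have hexpL : Real.exp L = x := by rw [hL, Real.exp_log hx0]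
  have hQexp : Q ≤ Real.exp (L / 8) := by
    refine le_exp_of_log_le (by linarith) ?_
    rw [le_div_iff₀ (by norm_num)]; nlinarith
  -- `ε = x^{−ν}`
  set ε : ℝ := x ^ (-ν) with hε
  have hε0 : 0 < ε := Real.rpow_pos_of_pos hx0 _
  have hε1 : ε ≤ 1 := Real.rpow_le_one_of_one_le_of_nonpos hx1.le (by linarith)
  have hεL : ε < L / 2 := by linarith
  have hεexp : ε = Real.exp (-(ν * L)) := by
    rw [hε, Real.rpow_def_of_pos hx0, ← hL]; ring_nf
  -- the Landau–Page package for the non-good zeros of `ζ₁_K`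
  obtain ⟨hLPreal, hLPuniq, hLPsimple⟩ := hpack K hKn
  have hregion : ∀ ρ : ℂ, dedekindZeta₁ K ρ = 0 →
      ¬ ρ.re ≤ 1 - c / (a * Real.log Q + Real.log (|ρ.im| + 4)) →
      (((1 : ClassGroup (𝓞 K) →* ℂˣ) = 1 → dedekindZeta₁ K ρ = 0) ∧
          ((1 : ClassGroup (𝓞 K) →* ℂˣ) ≠ 1 → classGroupLFunction₀ K 1 ρ = 0)) ∧
        1 - c₀ / (Real.log ((NumberField.discr K).natAbs : ℝ) + Real.log (|ρ.im| + 4)) < ρ.re := by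
    intro ρ h0 hng
    exact ⟨⟨fun _ ↦ h0, fun h ↦ absurd rfl h⟩, lpRegion_of_not_good K hK hc hcc₀ ha hng⟩
  have hreal : ∀ ρ : ℂ, dedekindZeta₁ K ρ = 0 → 0 < ρ.re → ρ.re < 1 →
      ¬ ρ.re ≤ 1 - c / (a * Real.log Q + Real.log (|ρ.im| + 4)) → ρ.im = 0 :=
    fun ρ h0 _ _ hng ↦ (hLPreal 1 ρ (hregion ρ h0 hng)).1
  have huniq : ∀ ρ₁ ρ₂ : ℂ, dedekindZeta₁ K ρ₁ = 0 → 0 < ρ₁.re → ρ₁.re < 1 →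
      ¬ ρ₁.re ≤ 1 - c / (a * Real.log Q + Real.log (|ρ₁.im| + 4)) →
      dedekindZeta₁ K ρ₂ = 0 → 0 < ρ₂.re → ρ₂.re < 1 →
      ¬ ρ₂.re ≤ 1 - c / (a * Real.log Q + Real.log (|ρ₂.im| + 4)) → ρ₁ = ρ₂ :=
    fun ρ₁ ρ₂ h1 _ _ hng1 h2 _ _ hng2 ↦ (hLPuniq 1 1 ρ₁ ρ₂ (hregion ρ₁ h1 hng1) (hregion ρ₂ h2 hng2)).2
  have hsimple : ∀ ρ : ℂ, dedekindZeta₁ K ρ = 0 → 0 < ρ.re → ρ.re < 1 →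
      ¬ ρ.re ≤ 1 - c / (a * Real.log Q + Real.log (|ρ.im| + 4)) →
      analyticOrderNatAt (dedekindZeta₁ K) ρ = 1 := by
    intro ρ h0 _ _ hng
    have h := ((hLPsimple 1 ρ (hregion ρ h0 hng)).1 rfl)
    have hne : analyticOrderAt (dedekindZeta₁ K) ρ ≠ ⊤ := by rw [h]; exact ENat.one_ne_top
    have : (analyticOrderNatAt (dedekindZeta₁ K) ρ : ℕ∞) = 1 := by
      rw [Nat.cast_analyticOrderNatAt hne, h]
    exact_mod_cast this
  -- the zero sum inside the region and the explicit formula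
  have hB := hZ c hc K hKn hdens x hxa₀ ε le_rfl hε1
  have hmain := re_coefFordK_one_tzTest_dichotomy (K := K) hx1 hε0 hεL c (a * Real.log Q)
    hreal huniq hsimple hB
  -- (i) + (ii): the zero sum is at most `x/400 + x/800`
  have heΛ : Real.exp (-Λ) ≤ (1 / 100) / (8 * A₀) := by
    refine exp_neg_le_of_neg_log_le (by positivity) ?_
    rw [← Real.log_inv, inv_div]; exact le_max_right _ _
  have hi : A₀ * x * (Real.exp (-(c * Real.log x / (4 * a * Real.log Q))) +
      Real.exp (-Real.sqrt (c * Real.log x / 4))) ≤ (1 / 100) / 4 * x := by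
    have h := zeroSum_main_small hc ha hA₀ hΛ0 hlogQ0 hL0 hLQ hL2a ha₁i ha₁i' heΛ
    rw [← hL]
    have := mul_le_mul_of_nonneg_left h hx0.le
    calc A₀ * x * (Real.exp (-(c * L / (4 * a * Real.log Q))) + Real.exp (-Real.sqrt (c * L / 4)))
        = x * (A₀ * (Real.exp (-(c * L / (4 * a * Real.log Q))) + Real.exp (-Real.sqrt (c * L / 4)))) := by
          ring
      _ ≤ x * ((1 / 100) / 4) := this
      _ = (1 / 100) / 4 * x := by ring
  have hii : A₀ * x ^ (1 - ν) ≤ (1 / 100) / 8 * x := by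
    have hxν : x ^ (1 - ν) = x * Real.exp (-(ν * L)) := by
      rw [← hεexp, hε, sub_eq_add_neg, Real.rpow_add hx0, Real.rpow_one]
    have hνL : Λ ≤ ν * L := by
      have := (div_le_iff₀ (by positivity)).1 ha₁ii; nlinarith
    have h1 : Real.exp (-(ν * L)) ≤ (1 / 100) / (8 * A₀) := (Real.exp_le_exp.2 (neg_le_neg hνL)).trans heΛ
    rw [hxν]
    calc A₀ * (x * Real.exp (-(ν * L))) ≤ A₀ * (x * ((1 / 100) / (8 * A₀))) :=
          mul_le_mul_of_nonneg_left (mul_le_mul_of_nonneg_left h1 hx0.le) hA₀.le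
      _ = (1 / 100) / 8 * x := by field_simp
  -- (iii): the trivial zero
  have hiii : (analyticOrderNatAt (dedekindZeta₁ K) 0 : ℝ) * (L + ε) ≤ (1 / 100) / 4 * x := by
    have h4 := trivialZero_term_le_one K hK (by linarith) hε0.le hε1 hQexp
    have he : (460800 : ℝ) ≤ Real.exp (3 * L / 4) := by
      refine le_exp_of_log_le (by positivity) ?_
      have := le_max_right 1 (Real.log 460800); rw [← hΛ₂] at this; linarith
    have hsplit : x = Real.exp (L / 4) * Real.exp (3 * L / 4) := by
      rw [← Real.exp_add, ← hexpL]; ring_nf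
    have h5 : 1152 * Real.exp (L / 4) ≤ (1 / 100) / 4 * x := by
      rw [hsplit]
      have := mul_le_mul_of_nonneg_left he (by positivity : (0:ℝ) ≤ (1 / 100) / 4 * Real.exp (L / 4))
      nlinarith [Real.exp_pos (L / 4)]
    linarith
  -- (iv): the left-line integral
  have hiv : ‖dzEFRemainder K (tzTest L ε) 0‖ ≤ (1 / 100) / 4 * x := by
    have hJ := leftLine_term_le_one hAl0 hAl hM K hK hL0 hε0 hεL hε1 hν64 hεexp hQexp
    rw [hKn] at hJ
    have hJ' : ‖dzEFRemainder K (tzTest L ε) 0‖ ≤ CJ := by rw [hCJ]; linarith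
    have he : 400 * (CJ + 1) ≤ x := by
      rw [← hexpL]
      refine le_exp_of_log_le (by positivity) ?_
      have := le_max_right 1 (Real.log (400 * (CJ + 1))); rw [← hΛ₃] at this; linarith
    linarith
  -- (v): `√x = e^{L/2} ≤ x/400`
  have hv : Real.exp (L / 2) ≤ (1 / 400) * x := by
    have h6 : (400 : ℝ) ≤ Real.exp (L / 2) :=
      exp_six_ge.trans (Real.exp_le_exp.2 (by linarith))
    have hsq : Real.exp (L / 2) * Real.exp (L / 2) = x := by rw [← Real.exp_add, ← hexpL]; ring_nf
    nlinarith [Real.exp_pos (L / 2)]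
  -- the main integral
  have hint : ∫ u in (L / 2)..L, Real.exp u = x - Real.exp (L / 2) := by
    rw [integral_exp, hexpL]
  -- the total of the secondary terms
  set R : ℝ := (A₀ * x * (Real.exp (-(c * Real.log x / (4 * a * Real.log Q))) +
      Real.exp (-Real.sqrt (c * Real.log x / 4))) + A₀ * x ^ (1 - ν)) +
    (analyticOrderNatAt (dedekindZeta₁ K) 0 : ℝ) * (Real.log x + ε) +
      ‖dzEFRemainder K (tzTest (Real.log x) ε) 0‖ with hR
  have hRle : R ≤ (7 / 800) * x := by
    rw [hR, ← hL]; linarith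
  rcases hmain with hgood | ⟨β₁, hz, hβ0, hβ1, hng, hlow⟩
  · -- no exceptional zero
    left
    rw [hint] at hgood
    linarith
  · -- an exceptional zero `β₁ > 1 − c/(a log Q + log 4) ≥ 15/16`
    have hβ1516 : 15 / 16 ≤ β₁ := by
      rw [not_le] at hng
      have hl4 : 0 ≤ Real.log (|(0:ℝ)| + 4) := Real.log_nonneg (by simp)
      have hden : 2 ≤ a * Real.log Q + Real.log (|(0:ℝ)| + 4) := by nlinarith
      have h1 : c / (a * Real.log Q + Real.log (|(0:ℝ)| + 4)) ≤ (1 / 8) / 2 :=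
        div_le_div₀ (by norm_num) hc8 (by norm_num) hden
      linarith
    by_cases h4 : 4 ≤ (1 - β₁) * L
    · -- absorbed: `x^{β₁}/β₁ ≤ x/50`
      left
      have hexc := integral_exp_mul_le_div hβ1516 h4
      rw [hexpL] at hexc
      have hsub : ∫ u in (L / 2)..L, (Real.exp u - Real.exp (β₁ * u)) =
          (∫ u in (L / 2)..L, Real.exp u) - ∫ u in (L / 2)..L, Real.exp (β₁ * u) := by
        refine intervalIntegral.integral_sub ?_ ?_
        · exact Real.continuous_exp.intervalIntegrable _ _
        · exact (Real.continuous_exp.comp (continuous_const.mul continuous_id)).intervalIntegrable _ _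
      rw [hsub, hint] at hlow
      linarith
    · rw [not_le] at h4
      by_cases hβQ : 1 - 1 / (8 * Real.log Q) < β₁
      · -- reported
        right
        refine ⟨β₁, hβQ, hβ1, ?_, h4⟩
        have hne : ((β₁ : ℝ) : ℂ) ≠ 1 := by
          intro h; apply hβ1.ne; exact_mod_cast h
        have h1 := dedekindZeta₁_apply_of_ne_one (K := K) hne
        rw [hz] at h1
        rcases mul_eq_zero.1 h1.symm with h2 | h2
        · exact absurd (sub_eq_zero.1 h2) hne
        · exact h2
      · -- impossible: `(1 − β₁) L ≥ L/(8 log Q) ≥ a₁/8 ≥ 4`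
        exfalso
        rw [not_lt] at hβQ
        have h1 : 1 / (8 * Real.log Q) ≤ 1 - β₁ := by linarith
        have h2 : 1 / (8 * Real.log Q) * L ≤ (1 - β₁) * L := mul_le_mul_of_nonneg_right h1 hL0.le
        have h3 : a₁ / 8 ≤ 1 / (8 * Real.log Q) * L := by
          rw [div_mul_eq_mul_div, one_mul, le_div_iff₀ (by positivity)]
          nlinarith
        linarith

end Summit.QuantumAdvantage.QuantumAdvantage.Theorems.DegreeOnePrimesEscape

end
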